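import Summits.NavierStokesRegularity.NavierStokesRegularity.Theorems.ExtremiserTransienceScrewSymmetricIsometryPowers
import Summits.NavierStokesRegularity.NavierStokesRegularity.Theorems.SqueezeCycleExtremalElementExistsExtraction
import Summits.NavierStokesRegularity.NavierStokesRegularity.Theorems.SymmetryModuliCountSymmetricLiouvilleRotationCovariance
import Summits.NavierStokesRegularity.NavierStokesRegularity.Theorems.SymmetryModuliCountSymmetricLiouvillePeriodicBlowdown
import HarnessLib

/-!
# Screw-symmetric Type-I ancient mild fields are small at `−∞` near the axis

Helper file for rung R8 `ScrewSymmetricLiouville` of LINE g9-β `filament_selection` on crux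
stmt-NavierStokesRegularity-26567 (`NearExtremalTransiencePerFlow`).

Let `u ∈ A_C` (`IsTypeIAncientMild C u`) be symmetric under a screw motion `x ↦ L x + b`,
`L` a linear isometry with `L b = b`: `u t (L x + b) = L (u t x)` for all `t < 0`. Then for every
`ε > 0` and every `D`, `√(−t)‖u(t, x)‖ ≤ ε` for all `t < T(ε, D)` and all `x` in the parabolic
neighbourhood `‖x‖ ≤ D √(−t)` of the origin (which lies on the screw axis).

Proof (KNSS 2009 §6 zoom-out, the tree's template `periodicBlowdownVanishing_axis`): violators
`(t_n, x_n)` with `‖x_n‖ ≤ D√(−t_n)`, `t_n → −∞`; the blow-downs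
`v_n(s, y) = λ_n u(λ_n² s, x_n + λ_n y)`, `λ_n = √(−t_n)`, lie in `A_C`, have `‖v_n(−1, 0)‖ > ε`
and are screw-symmetric WITH BOUNDED OFFSET:
`v_n(s, L^k y + (L^k q_n − q_n) + (k/λ_n) b) = L^k v_n(s, y)`, `q_n = x_n/λ_n`, `‖q_n‖ ≤ D`.
Returns of `k ↦ L^k` to the identity are SYNDETIC (bounded gaps; total boundedness of the set of
powers in `(EuclideanSpace ℝ (Fin 3)) →L[ℝ] (EuclideanSpace ℝ (Fin 3))`, centres in the set, isometry invariance of the operator norm — no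
rational/irrational case split), so for every `θ > 0` there are exponents `k_n` with `L^{k_n} → 1`
and `k_n/λ_n → θ`; hence an F3-limit `w ∈ A_C` of the `v_n` is invariant under the whole line
`ℝ b`, and vanishes by the PROVED `KNSS2009_typeI_rate_liouville_holds` (after rotating `b` onto
the `x₂`-axis and shifting time) — contradicting `‖w(−1, 0)‖ ≥ ε`.
[cite: KochNadirashviliSereginSverak2009, proof of Thm 6.2 (arXiv:0709.3599 p. 13)]
-/

noncomputable section

set_option linter.dupNamespace false

open Set Function Filter Metric
open scoped Topology

namespace Summit.NavierStokesRegularity.NavierStokesRegularity.Theorems.ScrewSymmetricLiouville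

open Literature.Analysis Literature.Analysis.FluidPDE
open Summit.NavierStokesRegularity.NavierStokesRegularity.Theorems
open Summit.NavierStokesRegularity.NavierStokesRegularity.Theorems.SymmetryModuliCountSymmetricLiouville

/-! ### The near-axis lever -/

/-- **Screw-symmetric Type-I ancient mild fields are small at `−∞` in every parabolic
neighbourhood of the axis.** For `u ∈ A_C` with `u t (L x + b) = L (u t x)` (`L` a linear isometry,
`L b = b`), every `ε > 0` and every `D`, there is `T < 0` with `√(−t)‖u(t, x)‖ ≤ ε` whenever
`t < T` and `‖x‖ ≤ D√(−t)` (`b ≠ 0`; the origin lies on the screw axis `ℝ b`). Module docstring for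
the proof. [cite: KochNadirashviliSereginSverak2009, proof of Thm 6.2 (arXiv:0709.3599 p. 13)] -/
theorem screwSymmetric_nearAxis_small (C : ℝ) (u : ℝ → (EuclideanSpace ℝ (Fin 3)) → (EuclideanSpace ℝ (Fin 3))) (L : (EuclideanSpace ℝ (Fin 3)) ≃ₗᵢ[ℝ] (EuclideanSpace ℝ (Fin 3))) (b : (EuclideanSpace ℝ (Fin 3)))
    (hu : IsTypeIAncientMild C u) (hLb : L b = b) (hb : b ≠ 0)
    (hsym : ∀ t : ℝ, t < 0 → ∀ x, u t (L x + b) = L (u t x)) :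
    ∀ ε > 0, ∀ D : ℝ, ∃ T < 0, ∀ t < T, ∀ x : (EuclideanSpace ℝ (Fin 3)), ‖x‖ ≤ D * Real.sqrt (-t) →
      Real.sqrt (-t) * ‖u t x‖ ≤ ε := by
  intro ε hε D
  by_contra hcon
  push Not at hcon
  -- violators `t_n < -(n+1)`, `‖x_n‖ ≤ D √(-t_n)`
  have hch : ∀ n : ℕ, ∃ tx : ℝ × (EuclideanSpace ℝ (Fin 3)), tx.1 < -((n : ℝ) + 1) ∧ ‖tx.2‖ ≤ D * Real.sqrt (-tx.1) ∧
      ε < Real.sqrt (-tx.1) * ‖u tx.1 tx.2‖ := by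
    intro n
    obtain ⟨t, ht, x, hx, hbig⟩ := hcon (-((n : ℝ) + 1)) (by linarith [(Nat.cast_nonneg n : (0 : ℝ) ≤ n)])
    exact ⟨(t, x), ht, hx, hbig⟩
  choose tx htx hDx hbig using hch
  set tn : ℕ → ℝ := fun n => (tx n).1 with htn
  set xn : ℕ → (EuclideanSpace ℝ (Fin 3)) := fun n => (tx n).2 with hxn
  have htn_lt : ∀ n, tn n < -((n : ℝ) + 1) := fun n => htx n
  have htn_neg : ∀ n, tn n < 0 := fun n =>
    (htn_lt n).trans_le (by linarith [(Nat.cast_nonneg n : (0 : ℝ) ≤ n)])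
  -- the scales `λ_n = √(-t_n)`
  set lam : ℕ → ℝ := fun n => Real.sqrt (-(tn n)) with hlam
  have hlam0 : ∀ n, 0 < lam n := fun n => Real.sqrt_pos.2 (neg_pos.2 (htn_neg n))
  have hlam2 : ∀ n, lam n ^ 2 = -(tn n) := fun n => Real.sq_sqrt (neg_nonneg.2 (htn_neg n).le)
  have hlam_ge' : ∀ n : ℕ, Real.sqrt ((n : ℝ) + 1) ≤ lam n := fun n => by
    rw [hlam]; exact Real.sqrt_le_sqrt (by linarith [htn_lt n])
  have hlam_top : Tendsto lam atTop atTop := by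
    have h1 : Tendsto (fun n : ℕ => Real.sqrt ((n : ℝ) + 1)) atTop atTop :=
      Real.tendsto_sqrt_atTop.comp (tendsto_natCast_atTop_atTop.atTop_add tendsto_const_nhds)
    exact tendsto_atTop_mono hlam_ge' h1
  -- the blow-downs
  set v : ℕ → ℝ → (EuclideanSpace ℝ (Fin 3)) → (EuclideanSpace ℝ (Fin 3)) := fun n => lam n • stPull (lam n ^ 2) (lam n) 0 (xn n) u with hv
  have hvcl : ∀ n, IsTypeIAncientMild C (v n) := fun n => isTypeIAncientMild_zoom hu (hlam0 n) (xn n)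
  have hv_apply : ∀ n s y, v n s y = lam n • u (lam n ^ 2 * s) (xn n + lam n • y) := fun n s y =>
    zoom_apply (lam n) (xn n) u s y
  -- nontrivial at the interior point `(-1, 0)`
  have hv1 : ∀ n, ε < ‖v n (-1) 0‖ := by
    intro n
    rw [hv_apply, smul_zero, add_zero, mul_neg_one, hlam2, neg_neg, norm_smul,
      Real.norm_of_nonneg (hlam0 n).le]
    exact hbig n
  -- the bounded offsets `q_n = x_n / λ_n`
  set q : ℕ → (EuclideanSpace ℝ (Fin 3)) := fun n => (lam n)⁻¹ • xn n with hq
  have hqD : ∀ n, ‖q n‖ ≤ D := by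
    intro n
    rw [hq]; dsimp only
    rw [norm_smul, norm_inv, Real.norm_of_nonneg (hlam0 n).le, inv_mul_le_iff₀ (hlam0 n), mul_comm]
    exact hDx n
  -- screw symmetry of the blow-downs, with bounded offset
  have hvsym : ∀ n, ∀ s < 0, ∀ (k : ℕ) (y : (EuclideanSpace ℝ (Fin 3))),
      v n s ((⇑L)^[k] y + ((⇑L)^[k] (q n) - q n) + ((k : ℝ) * (lam n)⁻¹) • b) = (⇑L)^[k] (v n s y) := by
    intro n s hs
    refine iterate_screw_symmetry L hLb (v := v n s) fun y => ?_
    have hs' : lam n ^ 2 * s < 0 := mul_neg_of_pos_of_neg (pow_pos (hlam0 n) 2) hs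
    rw [hv_apply, hv_apply]
    have e : xn n + lam n • (L y + (L (q n) - q n) + (lam n)⁻¹ • b) = L (xn n + lam n • y) + b := by
      have hlq : lam n • q n = xn n := by
        rw [hq]; dsimp only; rw [smul_smul, mul_inv_cancel₀ (hlam0 n).ne', one_smul]
      have hlLq : lam n • L (q n) = L (xn n) := by rw [← L.map_smul, hlq]
      rw [smul_add, smul_add, smul_sub, hlLq, hlq, smul_smul, mul_inv_cancel₀ (hlam0 n).ne', one_smul,
        map_add, L.map_smul]
      abel
    rw [e, hsym _ hs', L.map_smul]
  -- compactness: a limit `w ∈ A_C`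
  obtain ⟨φ, hφ, w, hw, -, -, hloc, -⟩ := exists_tendsto_of_isTypeIAncientMild_seq C hvcl
  have hwc : ∀ s < 0, Continuous (w s) := fun s hs => hw.continuous_slice hs
  have hpt : ∀ s < 0, ∀ y, Tendsto (fun n => v (φ n) s y) atTop (𝓝 (w s y)) := fun s hs y =>
    (hloc s hs).tendsto_comp (hwc s hs).continuousAt tendsto_const_nhds
  -- `‖w(-1, 0)‖ ≥ ε`
  have hw1 : ε ≤ ‖w (-1) 0‖ :=
    ge_of_tendsto ((hpt (-1) (by norm_num) 0).norm) (Eventually.of_forall fun n => (hv1 (φ n)).le)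
  -- `w` is invariant under the translations `θ • b`, `θ > 0`
  have hwinv_pos : ∀ s < 0, ∀ (y : (EuclideanSpace ℝ (Fin 3))) (θ : ℝ), 0 < θ → w s (y + θ • b) = w s y := by
    intro s hs y θ hθ
    have hlamφ : Tendsto (fun n => lam (φ n)) atTop atTop := hlam_top.comp hφ.tendsto_atTop
    obtain ⟨k, hk1, hk2⟩ := exists_good_exponents L hlamφ hθ
    -- the moving points `p_n → y + θ • b`
    set p : ℕ → (EuclideanSpace ℝ (Fin 3)) := fun n =>
      (⇑L)^[k n] y + ((⇑L)^[k n] (q (φ n)) - q (φ n)) + ((k n : ℝ) * (lam (φ n))⁻¹) • b with hp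
    have hp_lim : Tendsto p atTop (𝓝 (y + θ • b)) := by
      have h1 : Tendsto (fun n => (⇑L)^[k n] y) atTop (𝓝 y) := by
        rw [tendsto_iff_norm_sub_tendsto_zero]
        refine squeeze_zero (fun n => norm_nonneg _) (fun n => norm_iterate_sub_self_le L (k n) y) ?_
        simpa using hk2.mul_const ‖y‖
      have h2 : Tendsto (fun n => (⇑L)^[k n] (q (φ n)) - q (φ n)) atTop (𝓝 0) := by
        rw [tendsto_zero_iff_norm_tendsto_zero]
        refine squeeze_zero (fun n => norm_nonneg _)
          (fun n => (norm_iterate_sub_self_le L (k n) (q (φ n))).trans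
            (mul_le_mul_of_nonneg_left (hqD (φ n)) (norm_nonneg _))) ?_
        simpa using hk2.mul_const D
      have h3 : Tendsto (fun n => ((k n : ℝ) * (lam (φ n))⁻¹) • b) atTop (𝓝 (θ • b)) := by
        refine Tendsto.smul_const ?_ b
        simpa [div_eq_mul_inv] using hk1
      have := (h1.add h2).add h3
      simpa [hp] using this
    -- `v_{φ n} s p_n = L^{k_n} (v_{φ n} s y)`; pass to the limit on both sides
    have hleft : Tendsto (fun n => v (φ n) s (p n)) atTop (𝓝 (w s (y + θ • b))) :=
      (hloc s hs).tendsto_comp (hwc s hs).continuousAt hp_lim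
    have hright : Tendsto (fun n => (⇑L)^[k n] (v (φ n) s y)) atTop (𝓝 (w s y)) := by
      rw [tendsto_iff_norm_sub_tendsto_zero]
      have hb : ∀ n, ‖(⇑L)^[k n] (v (φ n) s y) - w s y‖ ≤
          ‖v (φ n) s y - w s y‖ + ‖(L.toLinearIsometry ^ (k n)).toContinuousLinearMap - 1‖ * ‖w s y‖ := fun n =>
        calc ‖(⇑L)^[k n] (v (φ n) s y) - w s y‖
            ≤ ‖(⇑L)^[k n] (v (φ n) s y) - (⇑L)^[k n] (w s y)‖ + ‖(⇑L)^[k n] (w s y) - w s y‖ :=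
              norm_sub_le_norm_sub_add_norm_sub _ _ _
          _ ≤ ‖v (φ n) s y - w s y‖ + ‖(L.toLinearIsometry ^ (k n)).toContinuousLinearMap - 1‖ * ‖w s y‖ := by
              rw [norm_iterate_sub]
              exact add_le_add le_rfl (norm_iterate_sub_self_le L (k n) (w s y))
      refine squeeze_zero (fun n => norm_nonneg _) hb ?_
      have h1 : Tendsto (fun n => ‖v (φ n) s y - w s y‖) atTop (𝓝 0) :=
        (tendsto_iff_norm_sub_tendsto_zero.1 (hpt s hs y))
      simpa using h1.add (hk2.mul_const ‖w s y‖)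
    have heq : (fun n => v (φ n) s (p n)) = fun n => (⇑L)^[k n] (v (φ n) s y) :=
      funext fun n => hvsym (φ n) s hs (k n) y
    rw [heq] at hleft
    exact tendsto_nhds_unique hleft hright
  -- hence under all translations along `b`
  have hwinv : ∀ s < 0, ∀ (y : (EuclideanSpace ℝ (Fin 3))) (θ : ℝ), w s (y + θ • b) = w s y := by
    intro s hs y θ
    rcases lt_trichotomy θ 0 with hθ | rfl | hθ
    · have h := hwinv_pos s hs (y + θ • b) (-θ) (by linarith)
      rw [add_assoc, ← add_smul, add_neg_cancel, zero_smul, add_zero] at h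
      exact h.symm
    · simp
    · exact hwinv_pos s hs y θ hθ
  -- rotate `b` onto the `x₂`-axis: `R b = ‖b‖ e₂`
  obtain ⟨R, hR⟩ := exists_linearIsometryEquiv_map_eq_smul_single b
  set wR : ℝ → (EuclideanSpace ℝ (Fin 3)) → (EuclideanSpace ℝ (Fin 3)) := fun t x => R (w t (R.symm x)) with hwR
  have hwRcl : IsTypeIAncientMild C wR := stub_rotationCovariance C R w hw
  -- the time shift `W = wR(· - 1/2)` is a bounded ancient mild field with the rate
  set W : ℝ → (EuclideanSpace ℝ (Fin 3)) → (EuclideanSpace ℝ (Fin 3)) := fun t => wR (t - 1 / 2) with hW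
  have hWcl : IsTypeIAncientMild C W := hwRcl.comp_sub_right (by norm_num : (0 : ℝ) ≤ 1 / 2)
  have hC : 0 ≤ C := hw.nonneg
  have hWb : ∃ K : ℝ, ∀ t < 0, ∀ x, ‖W t x‖ ≤ K := by
    refine ⟨C / Real.sqrt (1 / 2), fun t ht x => (hwRcl.norm_le (t := t - 1 / 2) (by linarith) x).trans ?_⟩
    exact div_le_div_of_nonneg_left hC (Real.sqrt_pos.2 (by norm_num)) (Real.sqrt_le_sqrt (by linarith))
  have hWr : ∀ t < 0, ∀ x, Real.sqrt (-t) * ‖W t x‖ ≤ C := by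
    intro t ht x
    calc Real.sqrt (-t) * ‖W t x‖ ≤ Real.sqrt (-t) * (C / Real.sqrt (-(t - 1 / 2))) :=
          mul_le_mul_of_nonneg_left (hwRcl.norm_le (by linarith) x) (Real.sqrt_nonneg _)
      _ ≤ C := sqrt_mul_div_sqrt_shift_le hC (by norm_num) ht
  have hbn : 0 < ‖b‖ := norm_pos_iff.2 hb
  have hWi : ∀ t < 0, ∀ (x : (EuclideanSpace ℝ (Fin 3))) (δ : ℝ), W t (x + EuclideanSpace.single (1 : Fin 3) δ) = W t x := by
    intro t ht x δ
    simp only [hW, hwR]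
    rw [map_add]
    have e : R.symm (EuclideanSpace.single (1 : Fin 3) δ) = (δ / ‖b‖) • b := by
      rw [SymmetryModuliCountSymmetricLiouville.single_one_eq_smul, R.symm.map_smul]
      have h2 : R.symm (EuclideanSpace.single (1 : Fin 3) (1 : ℝ)) = ‖b‖⁻¹ • b := by
        have h3 : R.symm (‖b‖ • EuclideanSpace.single (1 : Fin 3) (1 : ℝ)) = b := by
          rw [← hR, R.symm_apply_apply]
        rw [R.symm.map_smul] at h3
        calc R.symm (EuclideanSpace.single (1 : Fin 3) (1 : ℝ))
            = ‖b‖⁻¹ • (‖b‖ • R.symm (EuclideanSpace.single (1 : Fin 3) (1 : ℝ))) := by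
              rw [smul_smul, inv_mul_cancel₀ hbn.ne', one_smul]
          _ = ‖b‖⁻¹ • b := by rw [h3]
      rw [h2, smul_smul, div_eq_mul_inv]
    rw [e, hwinv (t - 1 / 2) (by linarith)]
  have hW0 : ∀ t < 0, ∀ x, W t x = 0 :=
    KNSS2009_typeI_rate_liouville_holds hWcl.continuousOn_uncurry hWb
      (fun t ht => hWcl.isWeaklyDivFree ht) (fun s t hst ht x => hWcl.mild_eq_heatExtension hst ht x)
      hWi hWr
  -- contradiction at `(-1, 0)`
  have hzero : w (-1) 0 = 0 := by
    have h := hW0 (-1 / 2) (by norm_num) (R 0)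
    simp only [hW, hwR, R.symm_apply_apply] at h
    norm_num at h
    simpa using h
  rw [hzero, norm_zero] at hw1
  exact absurd hw1 (not_le.2 hε)

end Summit.NavierStokesRegularity.NavierStokesRegularity.Theorems.ScrewSymmetricLiouville

end
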